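import Mathlib
import HarnessLib
import Summits.Ventures.LatticeQCDFlow.Exactness.SU2ResidualExactForceTransplant
import Summits.Ventures.LatticeQCDFlow.Exactness.SU2ResidualExactForceRegular

/-!
# VOLUME-UNIFORM CONSTANTS FOR THE LEARNED MEMBER: with ONE covering-natural, translation-covariant, staple-local, smooth conditioner evaluated on every torus, the exact force through the learned `SU(2)` residual member is bounded and Lipschitz with constants that do NOT depend on the lattice side

HONEST FRAMING: exact (Metropolis-corrected) sampling algorithms for lattice gauge theory;
figures of merit are autocorrelation/cost numbers at stated couplings and volumes; no
continuum-physics claim.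

Venture `LatticeQCDFlow` (cell pub-lqcd), topic `Exactness`; FANOUT row 14 (`eng-flowhmc`, engine
`latflow.fthmc`, family B: FT-HMC through the LEARNED residual member `maps.residual_trained_scan` on
`SU(2)` with the exact autodiff force, row 9's `n`-step Pauli-drift kernel `su2LeapfrogHMCN`).  NEW WORK
of the cell over the tree (`SU2ResidualExactForceTransplant`: the force at a link of the `L`-torus is
the force on a fixed reference torus at a transplanted field; `SU2ResidualExactForceRegular` (GEN-14):
`Φ_max`, `K_Φ` on ONE torus by compactness under a smooth conditioner; `LatticeForceVolumeUniform`: `phaseMask_proper`,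
`phaseMask_pull`; `SU2ExactForceTransplant.norm_transplant_sub_le`);  nothing is cited as a fact; no number.  First half (the REGULARITY half) of the
fifth file of the GEN-16 programme (VOLUME-UNIFORMITY for the LEARNED members): it needs neither the
member package nor the convergence machinery, only the transplant and ONE-torus compactness, and is
therefore its own file (GEN-17 split); the convergence half is `SU2ResidualExactForceVolumeUniform`.  Masks = the engine's
phase masks `x ↦ Σᵢ xᵢ mod w` (`w ∣ L`; parity: `w = 2`), written VERBATIM as
`ZMod.castHom hwL (ZMod w) (∑ j, x j)`; layer specs `s : σ` with direction `μf s`, class `bf s : ZMod w`,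
step `cf s`.

THE NETWORK.  A weight FAMILY `ρF M` indexed by the side `M` — ONE conditioner evaluated on every torus —
entering ONLY through the hypotheses
  (ρN) covering naturality along every `ZMod.castHom`, `w ∣ M ∣ M'`;  (ρT) covariance under the translations
  preserving the phase mask, on every torus `w ∣ M`;  (ρL) receptive radius `m` (weights at `e` read the `(m+1)`-ball at `e.1`);  (ρD)/(ρC) differentiable along
  differentiable link fields and `C^n` along `C^n` link fields (a smooth network);  (ρm) measurable;
  (ρloc) the weights at active links do not read active links;  (ρκ) the uniform refusal bound
  `|c_s|·Σ_ν(|ρ⁰| + |ρ¹|) ≤ κ₀ < 1` on every torus.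
A convolutional conditioner with SHARED weights, periodic padding, frozen-plaquette features and the
tanh squash meets them: (ρN), (ρT), (ρL), (ρloc), (ρm) are TYPED for window-stencil conditioners in
`LatticeStencilConditioner`, (ρκ) for the tanh squash in `SU2ResidualSquash`; (ρD)/(ρC) is a property
of the activation (smooth activations yes, LeakyReLU no).  PER-VOLUME RETRAINED WEIGHTS ARE A DIFFERENT
MEMBER ON EVERY TORUS — nothing here applies.

* §1 **`su2Residual_exactForce_regular_uniform`** — every schedule `sched`, `β, κ`: THERE ARE
  `Φ_max, K_Φ ≥ 0` SUCH THAT FOR EVERY SIDE `L` with `w ∣ L` and every `layers` packaged VERBATIM as in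
  `exists_layers_su2Residual` with the weights `ρF L` (positive densities) the exact force is measurable,
  `‖Φ_κ(V)_l‖ ≤ Φ_max`, `‖Φ_κ(V) − Φ_κ(V')‖ ≤ K_Φ‖V − V'‖_∞` (`Φ_max`, `K_Φ` = GEN-14's compactness
  constants on the reference torus of side `w(4(m+1)K+5)`, `K = sched.length`);
NOT CLAIMED: the values of `Φ_max`, `K_Φ`; FT-HMC convergence (the sequel); that a given
trained network meets (ρN)…(ρκ); layers of different receptive radii (take the largest `m`); longer
trajectories; OMF; floating point.
-/

noncomputable section

namespace Summit.Ventures.LatticeQCDFlow.Exactness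

open Set Function MeasureTheory ProbabilityTheory ProbabilityTheory.Kernel InnerProductGeometry WithLp NormedSpace
open Literature.MathematicalPhysics.QuantumFieldTheory
open Literature.MathematicalPhysics.QuantumFieldTheory.Balaban1983to89.B10Eq18SigmaSU2Haar (expPauli)
open scoped ENNReal Matrix Matrix.Norms.Operator NNReal

set_option backward.isDefEq.respectTransparency false

/-! ## §1 The exact force through the learned member: constants uniform in the volume -/

section Uniform

variable {d : ℕ} {σ : Type*}

/-- **THE EXACT FORCE THROUGH THE LEARNED `SU(2)` RESIDUAL MEMBER IS BOUNDED AND LIPSCHITZ UNIFORMLY IN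
THE VOLUME** for ONE conditioner evaluated on every torus ((ρN), (ρT), (ρL), (ρD), (ρC), (ρm), (ρloc),
(ρκ)).  Phase masks of width `w > 1`, ANY schedule `sched`, every `β, κ`: there are `Φ_max, K_Φ ≥ 0`
such that FOR EVERY side `L` with `w ∣ L` and every `layers` packaged VERBATIM as in
`exists_layers_su2Residual` with weights `ρF L` and positive densities, the exact force is measurable,
`‖Φ_κ(V)_l‖ ≤ Φ_max` and `‖Φ_κ(V) − Φ_κ(V')‖ ≤ K_Φ‖coeConfig V − coeConfig V'‖`. -/
theorem su2Residual_exactForce_regular_uniform (w : ℕ) [Fact (1 < w)]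
    (μf : σ → Fin d) (bf : σ → ZMod w) (cf : σ → ℝ)
    (ρF : ∀ M : ℕ, σ → GaugeConfig d M (Matrix.specialUnitaryGroup (Fin 2) ℂ) → Edge d M → Fin d → Fin 2 → ℝ) (m : ℕ)
    (hρN : (∀ (M M' : ℕ) (hwM : w ∣ M) (hMM : M ∣ M') (s : σ) (V : GaugeConfig d M (Matrix.specialUnitaryGroup (Fin 2) ℂ)) (e : Edge d M') (ν : Fin d) (t : Fin 2),
      ρF M' s (fun e : Edge d M' => V (fun i => ZMod.castHom hMM (ZMod M) (e.1 i), e.2)) e ν t =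
        ρF M s V ((fun j => ZMod.castHom hMM (ZMod M) (e.1 j)), e.2) ν t))
    (hρT : (∀ (M : ℕ) (hwM : w ∣ M) (t : Site d M), (∀ x : Site d M, ZMod.castHom hwM (ZMod w) (∑ j, (x + t) j) = ZMod.castHom hwM (ZMod w) (∑ j, x j)) →
      ∀ (s : σ) (W : GaugeConfig d M (Matrix.specialUnitaryGroup (Fin 2) ℂ)) (e : Edge d M) (ν : Fin d) (b : Fin 2),
      ρF M s (fun e : Edge d M => W (e.1 + t, e.2)) e ν b = ρF M s W (e.1 + t, e.2) ν b))
    (hρL : (∀ (M : ℕ) (s : σ) (U U' : GaugeConfig d M (Matrix.specialUnitaryGroup (Fin 2) ℂ)) (x : Site d M) (r : ℕ),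
      (∀ e : Edge d M, (∃ z : Fin d → ℤ, (∀ i, |z i| ≤ (((r+m+1) : ℕ) : ℤ)) ∧ e.1 = x + fun i => ((z i : ℤ) : ZMod M)) → U e = U' e) →
      ∀ e : Edge d M, (∃ z : Fin d → ℤ, (∀ i, |z i| ≤ ((r : ℕ) : ℤ)) ∧ e.1 = x + fun i => ((z i : ℤ) : ZMod M)) → ∀ (ν : Fin d) (t : Fin 2), ρF M s U e ν t = ρF M s U' e ν t))
    (hρD : (∀ (M : ℕ) [NeZero M] (s : σ) (U : (Edge d M → EuclideanSpace ℝ (Fin 3)) → GaugeConfig d M (Matrix.specialUnitaryGroup (Fin 2) ℂ))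
      (p₀ : Edge d M → EuclideanSpace ℝ (Fin 3)),
      (∀ e : Edge d M, DifferentiableAt ℝ (fun p => ((U p e : (Matrix.specialUnitaryGroup (Fin 2) ℂ)) : Matrix (Fin 2) (Fin 2) ℂ)) p₀) →
      ∀ (e : Edge d M) (ν : Fin d) (b : Fin 2), DifferentiableAt ℝ (fun p => ρF M s (U p) e ν b) p₀))
    (hρC : (∀ (M : ℕ) [NeZero M] {n : WithTop ℕ∞} (s : σ) (U : (Edge d M → Matrix (Fin 2) (Fin 2) ℂ) × (Edge d M → EuclideanSpace ℝ (Fin 3)) → GaugeConfig d M (Matrix.specialUnitaryGroup (Fin 2) ℂ)) (p₀ : (Edge d M → Matrix (Fin 2) (Fin 2) ℂ) × (Edge d M → EuclideanSpace ℝ (Fin 3))),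
      (∀ e : Edge d M, ContDiffAt ℝ n (fun p : (Edge d M → Matrix (Fin 2) (Fin 2) ℂ) × (Edge d M → EuclideanSpace ℝ (Fin 3)) => ((U p e : (Matrix.specialUnitaryGroup (Fin 2) ℂ)) : Matrix (Fin 2) (Fin 2) ℂ)) p₀) →
      ∀ (e : Edge d M) (ν : Fin d) (b : Fin 2), ContDiffAt ℝ n (fun p : (Edge d M → Matrix (Fin 2) (Fin 2) ℂ) × (Edge d M → EuclideanSpace ℝ (Fin 3)) => ρF M s (U p) e ν b) p₀))
    (hρm : (∀ (M : ℕ) (s : σ) (e : Edge d M) (ν : Fin d) (t : Fin 2), Measurable fun V : GaugeConfig d M (Matrix.specialUnitaryGroup (Fin 2) ℂ) => ρF M s V e ν t))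
    (hρloc : (∀ (M : ℕ) (hwM : w ∣ M) (s : σ) (V W : GaugeConfig d M (Matrix.specialUnitaryGroup (Fin 2) ℂ)),
      (∀ j : Edge d M, ¬(j.2 = μf s ∧ ZMod.castHom hwM (ZMod w) (∑ i, j.1 i) = bf s) → V j = W j) →
        ∀ e : Edge d M, (e.2 = μf s ∧ ZMod.castHom hwM (ZMod w) (∑ i, e.1 i) = bf s) → ∀ (ν : Fin d) (t : Fin 2), ρF M s V e ν t = ρF M s W e ν t))
    {κ₀ : ℝ} (hκ₀ : κ₀ < 1) (hκ : (∀ (M : ℕ) (hwM : w ∣ M) (s : σ) (V : GaugeConfig d M (Matrix.specialUnitaryGroup (Fin 2) ℂ)) (e : Edge d M), (e.2 = μf s ∧ ZMod.castHom hwM (ZMod w) (∑ i, e.1 i) = bf s) →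
      |cf s| * ∑ ν ∈ Finset.univ.erase e.2, (|ρF M s V e ν 0| + |ρF M s V e ν 1|) ≤ κ₀))
    (sched : List σ) (β κ : ℝ) :
    ∃ Φmax KΦ : ℝ, 0 ≤ Φmax ∧ 0 ≤ KΦ ∧ ∀ (L : ℕ) [NeZero L] (hwL : w ∣ L)
      (layers : List ((GaugeConfig d L (Matrix.specialUnitaryGroup (Fin 2) ℂ) ≃ᵐ GaugeConfig d L (Matrix.specialUnitaryGroup (Fin 2) ℂ)) × (GaugeConfig d L (Matrix.specialUnitaryGroup (Fin 2) ℂ) → ℝ)))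
      (_hmap :
        layers.map (fun Ly => ((Ly.1 : GaugeConfig d L (Matrix.specialUnitaryGroup (Fin 2) ℂ) → GaugeConfig d L (Matrix.specialUnitaryGroup (Fin 2) ℂ)), Ly.2)) =
        sched.map (fun s =>
          ((fun (V : GaugeConfig d L (Matrix.specialUnitaryGroup (Fin 2) ℂ)) (e : Edge d L) =>
        if e.2 = μf s ∧ (ZMod.castHom hwL (ZMod w) (∑ j, e.1 j)) = bf s then
          gaussUnit (geodesicKick (cf s) (∑ ν ∈ Finset.univ.erase e.2,
            (ρF L s V e ν 0 • vecQuat (((V (Site.shift e.1 e.2, ν) * (V (Site.shift e.1 ν, e.2))⁻¹ * (V (e.1, ν))⁻¹)⁻¹ : Matrix.specialUnitaryGroup (Fin 2) ℂ) : Matrix (Fin 2) (Fin 2) ℂ) +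
              ρF L s V e ν 1 • vecQuat ((((V (Site.shift (e.1 - Pi.single ν 1) e.2, ν))⁻¹ * (V (e.1 - Pi.single ν 1, e.2))⁻¹ * V (e.1 - Pi.single ν 1, ν))⁻¹ : Matrix.specialUnitaryGroup (Fin 2) ℂ) : Matrix (Fin 2) (Fin 2) ℂ)))
            (vecQuat ((V e : Matrix.specialUnitaryGroup (Fin 2) ℂ) : Matrix (Fin 2) (Fin 2) ℂ)))
        else V e),
           fun V : GaugeConfig d L (Matrix.specialUnitaryGroup (Fin 2) ℂ) => ∏ a : {e : Edge d L // e.2 = μf s ∧ (ZMod.castHom hwL (ZMod w) (∑ j, e.1 j)) = bf s},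
          (if Real.sin (angle (∑ ν ∈ Finset.univ.erase a.1.2,
            (ρF L s V a.1 ν 0 • vecQuat (((V (Site.shift a.1.1 a.1.2, ν) * (V (Site.shift a.1.1 ν, a.1.2))⁻¹ * (V (a.1.1, ν))⁻¹)⁻¹ : Matrix.specialUnitaryGroup (Fin 2) ℂ) : Matrix (Fin 2) (Fin 2) ℂ) +
              ρF L s V a.1 ν 1 • vecQuat ((((V (Site.shift (a.1.1 - Pi.single ν 1) a.1.2, ν))⁻¹ * (V (a.1.1 - Pi.single ν 1, a.1.2))⁻¹ * V (a.1.1 - Pi.single ν 1, ν))⁻¹ : Matrix.specialUnitaryGroup (Fin 2) ℂ) : Matrix (Fin 2) (Fin 2) ℂ))) (vecQuat ((V a.1 : Matrix.specialUnitaryGroup (Fin 2) ℂ) : Matrix (Fin 2) (Fin 2) ℂ))) = 0 then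
            (1 - cf s * ‖(∑ ν ∈ Finset.univ.erase a.1.2,
            (ρF L s V a.1 ν 0 • vecQuat (((V (Site.shift a.1.1 a.1.2, ν) * (V (Site.shift a.1.1 ν, a.1.2))⁻¹ * (V (a.1.1, ν))⁻¹)⁻¹ : Matrix.specialUnitaryGroup (Fin 2) ℂ) : Matrix (Fin 2) (Fin 2) ℂ) +
              ρF L s V a.1 ν 1 • vecQuat ((((V (Site.shift (a.1.1 - Pi.single ν 1) a.1.2, ν))⁻¹ * (V (a.1.1 - Pi.single ν 1, a.1.2))⁻¹ * V (a.1.1 - Pi.single ν 1, ν))⁻¹ : Matrix.specialUnitaryGroup (Fin 2) ℂ) : Matrix (Fin 2) (Fin 2) ℂ)))‖ * Real.cos (angle (∑ ν ∈ Finset.univ.erase a.1.2,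
            (ρF L s V a.1 ν 0 • vecQuat (((V (Site.shift a.1.1 a.1.2, ν) * (V (Site.shift a.1.1 ν, a.1.2))⁻¹ * (V (a.1.1, ν))⁻¹)⁻¹ : Matrix.specialUnitaryGroup (Fin 2) ℂ) : Matrix (Fin 2) (Fin 2) ℂ) +
              ρF L s V a.1 ν 1 • vecQuat ((((V (Site.shift (a.1.1 - Pi.single ν 1) a.1.2, ν))⁻¹ * (V (a.1.1 - Pi.single ν 1, a.1.2))⁻¹ * V (a.1.1 - Pi.single ν 1, ν))⁻¹ : Matrix.specialUnitaryGroup (Fin 2) ℂ) : Matrix (Fin 2) (Fin 2) ℂ))) (vecQuat ((V a.1 : Matrix.specialUnitaryGroup (Fin 2) ℂ) : Matrix (Fin 2) (Fin 2) ℂ)))) ^ 3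
          else kickJac (cf s * ‖(∑ ν ∈ Finset.univ.erase a.1.2,
            (ρF L s V a.1 ν 0 • vecQuat (((V (Site.shift a.1.1 a.1.2, ν) * (V (Site.shift a.1.1 ν, a.1.2))⁻¹ * (V (a.1.1, ν))⁻¹)⁻¹ : Matrix.specialUnitaryGroup (Fin 2) ℂ) : Matrix (Fin 2) (Fin 2) ℂ) +
              ρF L s V a.1 ν 1 • vecQuat ((((V (Site.shift (a.1.1 - Pi.single ν 1) a.1.2, ν))⁻¹ * (V (a.1.1 - Pi.single ν 1, a.1.2))⁻¹ * V (a.1.1 - Pi.single ν 1, ν))⁻¹ : Matrix.specialUnitaryGroup (Fin 2) ℂ) : Matrix (Fin 2) (Fin 2) ℂ)))‖) 2 (angle (∑ ν ∈ Finset.univ.erase a.1.2,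
            (ρF L s V a.1 ν 0 • vecQuat (((V (Site.shift a.1.1 a.1.2, ν) * (V (Site.shift a.1.1 ν, a.1.2))⁻¹ * (V (a.1.1, ν))⁻¹)⁻¹ : Matrix.specialUnitaryGroup (Fin 2) ℂ) : Matrix (Fin 2) (Fin 2) ℂ) +
              ρF L s V a.1 ν 1 • vecQuat ((((V (Site.shift (a.1.1 - Pi.single ν 1) a.1.2, ν))⁻¹ * (V (a.1.1 - Pi.single ν 1, a.1.2))⁻¹ * V (a.1.1 - Pi.single ν 1, ν))⁻¹ : Matrix.specialUnitaryGroup (Fin 2) ℂ) : Matrix (Fin 2) (Fin 2) ℂ))) (vecQuat ((V a.1 : Matrix.specialUnitaryGroup (Fin 2) ℂ) : Matrix (Fin 2) (Fin 2) ℂ)))))))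
      (_hpos : ∀ Ly ∈ layers, ∀ V, 0 < Ly.2 V),
      Measurable (fun (V : GaugeConfig d L (Matrix.specialUnitaryGroup (Fin 2) ℂ)) (l : Edge d L) => κ • WithLp.toLp 2 (fun i : Fin 3 =>
        fderiv ℝ (fun a : Edge d L → EuclideanSpace ℝ (Fin 3) => β * wilsonAction (Matrix.specialUnitaryGroup (Fin 2) ℂ).subtype ((layers.foldr (fun Ly (F : GaugeConfig d L (Matrix.specialUnitaryGroup (Fin 2) ℂ) ≃ᵐ GaugeConfig d L (Matrix.specialUnitaryGroup (Fin 2) ℂ)) => Ly.1.trans F) (MeasurableEquiv.refl (GaugeConfig d L (Matrix.specialUnitaryGroup (Fin 2) ℂ)))) ((fun l : Edge d L => expPauli (a l)) * V)) - Real.log ((layers.foldr (fun Ly K => fun v => Ly.2 v * K (Ly.1 v)) (fun _ => (1 : ℝ))) ((fun l : Edge d L => expPauli (a l)) * V))) 0 (Pi.single l (EuclideanSpace.single i (1 : ℝ))))) ∧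
      (∀ (V : GaugeConfig d L (Matrix.specialUnitaryGroup (Fin 2) ℂ)) (l : Edge d L),
        ‖(fun (V : GaugeConfig d L (Matrix.specialUnitaryGroup (Fin 2) ℂ)) (l : Edge d L) => κ • WithLp.toLp 2 (fun i : Fin 3 =>
        fderiv ℝ (fun a : Edge d L → EuclideanSpace ℝ (Fin 3) => β * wilsonAction (Matrix.specialUnitaryGroup (Fin 2) ℂ).subtype ((layers.foldr (fun Ly (F : GaugeConfig d L (Matrix.specialUnitaryGroup (Fin 2) ℂ) ≃ᵐ GaugeConfig d L (Matrix.specialUnitaryGroup (Fin 2) ℂ)) => Ly.1.trans F) (MeasurableEquiv.refl (GaugeConfig d L (Matrix.specialUnitaryGroup (Fin 2) ℂ)))) ((fun l : Edge d L => expPauli (a l)) * V)) - Real.log ((layers.foldr (fun Ly K => fun v => Ly.2 v * K (Ly.1 v)) (fun _ => (1 : ℝ))) ((fun l : Edge d L => expPauli (a l)) * V))) 0 (Pi.single l (EuclideanSpace.single i (1 : ℝ))))) V l‖ ≤ Φmax) ∧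
      (∀ V V' : GaugeConfig d L (Matrix.specialUnitaryGroup (Fin 2) ℂ),
        ‖(fun (V : GaugeConfig d L (Matrix.specialUnitaryGroup (Fin 2) ℂ)) (l : Edge d L) => κ • WithLp.toLp 2 (fun i : Fin 3 =>
        fderiv ℝ (fun a : Edge d L → EuclideanSpace ℝ (Fin 3) => β * wilsonAction (Matrix.specialUnitaryGroup (Fin 2) ℂ).subtype ((layers.foldr (fun Ly (F : GaugeConfig d L (Matrix.specialUnitaryGroup (Fin 2) ℂ) ≃ᵐ GaugeConfig d L (Matrix.specialUnitaryGroup (Fin 2) ℂ)) => Ly.1.trans F) (MeasurableEquiv.refl (GaugeConfig d L (Matrix.specialUnitaryGroup (Fin 2) ℂ)))) ((fun l : Edge d L => expPauli (a l)) * V)) - Real.log ((layers.foldr (fun Ly K => fun v => Ly.2 v * K (Ly.1 v)) (fun _ => (1 : ℝ))) ((fun l : Edge d L => expPauli (a l)) * V))) 0 (Pi.single l (EuclideanSpace.single i (1 : ℝ))))) V -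
          (fun (V : GaugeConfig d L (Matrix.specialUnitaryGroup (Fin 2) ℂ)) (l : Edge d L) => κ • WithLp.toLp 2 (fun i : Fin 3 =>
        fderiv ℝ (fun a : Edge d L → EuclideanSpace ℝ (Fin 3) => β * wilsonAction (Matrix.specialUnitaryGroup (Fin 2) ℂ).subtype ((layers.foldr (fun Ly (F : GaugeConfig d L (Matrix.specialUnitaryGroup (Fin 2) ℂ) ≃ᵐ GaugeConfig d L (Matrix.specialUnitaryGroup (Fin 2) ℂ)) => Ly.1.trans F) (MeasurableEquiv.refl (GaugeConfig d L (Matrix.specialUnitaryGroup (Fin 2) ℂ)))) ((fun l : Edge d L => expPauli (a l)) * V)) - Real.log ((layers.foldr (fun Ly K => fun v => Ly.2 v * K (Ly.1 v)) (fun _ => (1 : ℝ))) ((fun l : Edge d L => expPauli (a l)) * V))) 0 (Pi.single l (EuclideanSpace.single i (1 : ℝ))))) V'‖ ≤ KΦ * ‖coeConfig V - coeConfig V'‖) := by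
  have hw1 : 1 < w := Fact.out
  have hκlt : ∀ (M : ℕ) (hwM : w ∣ M) (s : σ) (V : GaugeConfig d M (Matrix.specialUnitaryGroup (Fin 2) ℂ)) (e : Edge d M),
      (e.2 = μf s ∧ ZMod.castHom hwM (ZMod w) (∑ i, e.1 i) = bf s) →
      |cf s| * ∑ ν ∈ Finset.univ.erase e.2, (|ρF M s V e ν 0| + |ρF M s V e ν 1|) < 1 :=
    fun M hwM s V e he => (hκ M hwM s V e he).trans_lt hκ₀
  -- the reference torus of side `L₁ = w (2R + 1)`, `R = 2K + 2`
  haveI : NeZero (w*(2*(0+2*(m+1)*sched.length+2)+1)) := ⟨mul_ne_zero (by omega) (by omega)⟩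
  have hwL₁ : w ∣ (w*(2*(0+2*(m+1)*sched.length+2)+1)) := Dvd.intro _ rfl
  have hR : 2 * (0 + 2 * (m+1) * sched.length + 2) < (w*(2*(0+2*(m+1)*sched.length+2)+1)) :=
    lt_of_lt_of_le (Nat.lt_succ_self _) (Nat.le_mul_of_pos_left _ (by omega))
  have hχ₁ : ∀ (x : Site d (w*(2*(0+2*(m+1)*sched.length+2)+1))) (i : Fin d),
      ZMod.castHom hwL₁ (ZMod w) (∑ j, (Site.shift x i) j) ≠ ZMod.castHom hwL₁ (ZMod w) (∑ j, x j) :=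
    fun x i => phaseMask_proper hwL₁ x i
  obtain ⟨layers₁, hmap₁, hpos₁, -, -⟩ := exists_layers_su2Residual
    (fun x : Site d (w*(2*(0+2*(m+1)*sched.length+2)+1)) => ZMod.castHom hwL₁ (ZMod w) (∑ j, x j)) hχ₁ μf bf cf
    (ρF (w*(2*(0+2*(m+1)*sched.length+2)+1))) (hρm _) (hρloc _ hwL₁) (hκlt _ hwL₁) sched
  obtain ⟨-, Φmax, KΦ, hΦ0, hK0, hb₁, hK₁⟩ := su2Residual_exactForce_regular
    (fun x : Site d (w*(2*(0+2*(m+1)*sched.length+2)+1)) => ZMod.castHom hwL₁ (ZMod w) (∑ j, x j)) μf bf cf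
    (ρF (w*(2*(0+2*(m+1)*sched.length+2)+1))) (hρC _) sched layers₁ hmap₁ hpos₁ β κ
  refine ⟨Φmax, KΦ, hΦ0, hK0, fun L _ hwL layers hmap hpos => ?_⟩
  obtain ⟨hΦm, -⟩ := su2Residual_exactForce_regular
    (fun x : Site d L => ZMod.castHom hwL (ZMod w) (∑ j, x j)) μf bf cf (ρF L) (hρC L) sched layers hmap hpos β κ
  -- the big torus `L·L₁` and its phase mask
  haveI : NeZero (L * (w*(2*(0+2*(m+1)*sched.length+2)+1))) :=
    ⟨mul_ne_zero (NeZero.ne L) (NeZero.ne (w*(2*(0+2*(m+1)*sched.length+2)+1)))⟩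
  have hwM : w ∣ L * (w*(2*(0+2*(m+1)*sched.length+2)+1)) := Dvd.dvd.mul_right hwL _
  have hχM : ∀ (x : Site d (L * (w*(2*(0+2*(m+1)*sched.length+2)+1)))) (i : Fin d),
      ZMod.castHom hwM (ZMod w) (∑ j, (Site.shift x i) j) ≠ ZMod.castHom hwM (ZMod w) (∑ j, x j) :=
    fun x i => phaseMask_proper hwM x i
  obtain ⟨layersM, hmapM, hposM, -, -⟩ := exists_layers_su2Residual
    (fun x : Site d (L * (w*(2*(0+2*(m+1)*sched.length+2)+1))) => ZMod.castHom hwM (ZMod w) (∑ j, x j)) hχM μf bf cf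
    (ρF (L * (w*(2*(0+2*(m+1)*sched.length+2)+1)))) (hρm _) (hρloc _ hwM) (hκlt _ hwM) sched
  have hχ1 : ∀ x : Site d (L * (w*(2*(0+2*(m+1)*sched.length+2)+1))),
      ZMod.castHom hwM (ZMod w) (∑ j, x j) =
        ZMod.castHom hwL (ZMod w) (∑ j, (ZMod.castHom (dvd_mul_right L (w*(2*(0+2*(m+1)*sched.length+2)+1))) (ZMod L)) (x j)) :=
    fun x => phaseMask_pull hwM hwL _ x
  have hχ2 : ∀ x : Site d (L * (w*(2*(0+2*(m+1)*sched.length+2)+1))),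
      ZMod.castHom hwM (ZMod w) (∑ j, x j) =
        ZMod.castHom hwL₁ (ZMod w) (∑ j, (ZMod.castHom (dvd_mul_left (w*(2*(0+2*(m+1)*sched.length+2)+1)) L)
          (ZMod (w*(2*(0+2*(m+1)*sched.length+2)+1)))) (x j)) :=
    fun x => phaseMask_pull hwM hwL₁ _ x
  have htr := fun (V : GaugeConfig d L (Matrix.specialUnitaryGroup (Fin 2) ℂ)) (l : Edge d L) =>
    su2Residual_exactForce_transplant
      (fun x : Site d L => ZMod.castHom hwL (ZMod w) (∑ j, x j))
      (fun x : Site d (w*(2*(0+2*(m+1)*sched.length+2)+1)) => ZMod.castHom hwL₁ (ZMod w) (∑ j, x j))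
      (fun x : Site d (L * (w*(2*(0+2*(m+1)*sched.length+2)+1))) => ZMod.castHom hwM (ZMod w) (∑ j, x j))
      μf bf cf (ρF L) (ρF (w*(2*(0+2*(m+1)*sched.length+2)+1))) (ρF (L * (w*(2*(0+2*(m+1)*sched.length+2)+1)))) m
      hχ1 hχ2 sched (fun s _ => hρN _ _ hwL _ s) (fun s _ => hρN _ _ hwL₁ _ s) (hρT _ hwM) (fun s _ => hρL _ s)
      (hρD (L * (w*(2*(0+2*(m+1)*sched.length+2)+1))))
      layers layers₁ layersM hmap hmap₁ hmapM hposM hR β κ V l l.1 rfl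
  refine ⟨hΦm, fun V l => ?_, fun V V' => ?_⟩
  · rw [htr V l]
    exact hb₁ _ _
  · set Φ₁ := (fun (V : GaugeConfig d (w*(2*(0+2*(m+1)*sched.length+2)+1)) (Matrix.specialUnitaryGroup (Fin 2) ℂ)) (l : Edge d (w*(2*(0+2*(m+1)*sched.length+2)+1))) => κ • WithLp.toLp 2 (fun i : Fin 3 =>
        fderiv ℝ (fun a : Edge d (w*(2*(0+2*(m+1)*sched.length+2)+1)) → EuclideanSpace ℝ (Fin 3) => β * wilsonAction (Matrix.specialUnitaryGroup (Fin 2) ℂ).subtype ((layers₁.foldr (fun Ly (F : GaugeConfig d (w*(2*(0+2*(m+1)*sched.length+2)+1)) (Matrix.specialUnitaryGroup (Fin 2) ℂ) ≃ᵐ GaugeConfig d (w*(2*(0+2*(m+1)*sched.length+2)+1)) (Matrix.specialUnitaryGroup (Fin 2) ℂ)) => Ly.1.trans F) (MeasurableEquiv.refl (GaugeConfig d (w*(2*(0+2*(m+1)*sched.length+2)+1)) (Matrix.specialUnitaryGroup (Fin 2) ℂ)))) ((fun l : Edge d (w*(2*(0+2*(m+1)*sched.length+2)+1)) => expPauli (a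 l)) * V)) - Real.log ((layers₁.foldr (fun Ly K => fun v => Ly.2 v * K (Ly.1 v)) (fun _ => (1 : ℝ))) ((fun l : Edge d (w*(2*(0+2*(m+1)*sched.length+2)+1)) => expPauli (a l)) * V))) 0 (Pi.single l (EuclideanSpace.single i (1 : ℝ))))) with hΦ₁
    have key : ∀ (f g : Edge d (w*(2*(0+2*(m+1)*sched.length+2)+1)) → EuclideanSpace ℝ (Fin 3))
        (i : Edge d (w*(2*(0+2*(m+1)*sched.length+2)+1))), ‖f i - g i‖ ≤ ‖f - g‖ :=
      fun f g i => norm_le_pi_norm (f - g) i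
    refine (pi_norm_le_iff_of_nonneg (by positivity)).2 fun l => ?_
    rw [Pi.sub_apply, htr V l, htr V' l]
    exact ((key _ _ _).trans (hK₁ _ _)).trans (mul_le_mul_of_nonneg_left (norm_transplant_sub_le l.1 _ V V') hK0)

end Uniform

end Summit.Ventures.LatticeQCDFlow.Exactness
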